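import Mathlib
import Summits.ResolutionOfSingularities.ResolutionOfSingularities.Theorems.WeightedInvariantLocalWeightedDropTOT2CurveConflictGraphMove
import Summits.ResolutionOfSingularities.ResolutionOfSingularities.Theorems.WeightedInvariantLocalWeightedDropPolyDescentPrepExists
import Summits.ResolutionOfSingularities.ResolutionOfSingularities.Theorems.WeightedInvariantLocalWeightedDropPolyDescentBridgeExits

/-!
# `LocalWeightedDrop`, NC count game — TOT2-LINE piece S-CRV (v1.1 (D)), part 5: second branches at the ACTUAL graph-curve successor of
# `PolyDescent.succT` (F7 instantiated with the ε-chosen shear `graphShearT` and the preparation `prep`)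

[OURS · L1 W4.3 · chain w43, engine crux `LocalWeightedDrop` stmt-ResolutionOfSingularities-8899; sub-line under the v32 registered stub
`stub_spaceNCRankDrop`; piece S-CRV = res-type-088; `--supports 8899 --as helper`, counted 0; definition-free; nothing here is a statement of any
manuscript; AI-written (gate-accepted = sorry-free with standard axioms, not refereed).]

* `isPermissibleTwoT_prep_shearT_graphShearT` — the centre of succT's graph-curve move is permissible for the prepared sheared label (row transfer
  `isPermissibleTwoT_of_wellPrepared_of_isPermissibleTwoT_shift` + (ρ-P) `stub_polyPrep`; the pattern of `PolyDescent.…RegimeRank`);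
* **`hasGraphCurveT_succT_graph`** — if `A` (a position with a graph curve) carries a SECOND permissible graph branch with datum `h₂ ≠ graphShearT d A`,
  then succT's graph-curve successor `divTwoT d (prep d (shearT (graphShearT d A) A))` has a graph curve (datum `h₂ − graphShearT d A`, part 4):
  together with `u₂ ∈ N′` after the move (the new exceptional letter) this is a CONFLICT state of the TOT2-LINE born on-strategy whenever the new
  label is not coordinate-permissible.
-/

set_option linter.dupNamespace false -- mandated namespace of this single-conjunct summit

noncomputable section

namespace Summit.ResolutionOfSingularities.ResolutionOfSingularities.Theorems

namespace TOT2Curve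

open MvPowerSeries PolyDescent MonicDescent WildMonic Literature.AlgebraicGeometry.Resolution

variable {k : Type} [Field k] {d : ℕ}

/-- The prepared sheared label of succT's graph-curve move is a position with `V(y,u₂)` permissible. -/
theorem isPermissibleTwoT_prep_shearT_graphShearT (hd : 0 < d) (A : Fin d → MvPowerSeries (Fin 2) k) (hpos : IsPosT d A)
    (hG : HasGraphCurveT d A) :
    IsPosT d (prep d (shearT (graphShearT d A) A)) ∧ IsPermissibleTwoT d (prep d (shearT (graphShearT d A) A)) := by
  obtain ⟨ψ, -, -, hperm⟩ := graphShearT_spec hG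
  have hposY : IsPosT d (shearT (graphShearT d A) A) := isPosT_shearT _ hpos
  obtain ⟨-, hposB, hWPB, -⟩ := isPrepRecentring_prepPsi (stub_polyPrep k d hd _ hposY)
  refine ⟨hposB, isPermissibleTwoT_of_wellPrepared_of_isPermissibleTwoT_shift hd hWPB
    (φ := ψ - prepPsi d (shearT (graphShearT d A) A)) ?_⟩
  rw [PolyDescent.prep, PolyDescent.shift_shift, sub_add_cancel]
  exact hperm

/-- **SECOND BRANCHES AT succT's GRAPH-CURVE SUCCESSOR.**  If the position `A` has a graph curve and carries a second permissible graph branch with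
`u₁`-only datum `h₂ ≠ graphShearT d A`, then the graph-curve successor `divTwoT d (prep d (shearT (graphShearT d A) A))` of `PolyDescent.succT`
again has a graph curve (with datum `h₂ − graphShearT d A`). -/
theorem hasGraphCurveT_succT_graph (hd : 0 < d) (A : Fin d → MvPowerSeries (Fin 2) k) (hpos : IsPosT d A) (hG : HasGraphCurveT d A)
    (h₂ ψ₂ : MvPowerSeries (Fin 2) k) (hh₂ : ∀ e : Fin 2 →₀ ℕ, e 1 ≠ 0 → coeff e h₂ = 0) (hne : h₂ ≠ graphShearT d A)
    (hperm₂ : IsPermissibleTwoT d (shift d (shearT h₂ A) ψ₂)) :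
    HasGraphCurveT d (divTwoT d (prep d (shearT (graphShearT d A) A))) := by
  obtain ⟨ψ, hh, -, -⟩ := graphShearT_spec hG
  obtain ⟨hposB, hpermB⟩ := isPermissibleTwoT_prep_shearT_graphShearT hd A hpos hG
  rw [PolyDescent.prep] at hposB hpermB ⊢
  exact hasGraphCurveT_graphMove hd A (graphShearT d A) h₂ ψ₂ _ hh hh₂ hne hperm₂ hposB hpermB

/-- The same with the successor named through `succT`: the unique succT-successor of a position in the graph-curve case has a graph curve. -/
theorem hasGraphCurveT_of_mem_succT_graph (hd : 0 < d) (A : Fin d → MvPowerSeries (Fin 2) k) (hpos : IsPosT d A)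
    (h1 : ¬ IsPermissibleOneT d A) (h2 : ¬ IsPermissibleTwoT d A) (hG : HasGraphCurveT d A)
    (h₂ ψ₂ : MvPowerSeries (Fin 2) k) (hh₂ : ∀ e : Fin 2 →₀ ℕ, e 1 ≠ 0 → coeff e h₂ = 0) (hne : h₂ ≠ graphShearT d A)
    (hperm₂ : IsPermissibleTwoT d (shift d (shearT h₂ A) ψ₂)) {A' : Fin d → MvPowerSeries (Fin 2) k} (hA' : A' ∈ succT d A) :
    HasGraphCurveT d A' := by
  rw [succT_of_hasGraphCurveT h1 h2 hG, Set.mem_singleton_iff] at hA'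
  rw [hA']
  exact hasGraphCurveT_succT_graph hd A hpos hG h₂ ψ₂ hh₂ hne hperm₂

end TOT2Curve

end Summit.ResolutionOfSingularities.ResolutionOfSingularities.Theorems

end
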